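import Literature.ModelTheory.ProofTheory.PreSemantics

/-!
# A Hilbert calculus on pre-sentences, its soundness and its deduction theorem

Support file for the proof of the enumerability theorem
(`FirstOrder.Language.Theory.IsComputablyAxiomatizable.isRE`; Enderton, *A Mathematical
Introduction to Logic*, §2.4–2.5). We set up a Hilbert-style deductive calculus `Derives U φ`
("`φ` is derivable using exactly the list of hypotheses `U`") on the pre-formulas of
`Literature/ModelTheory/ProofTheory/PreSyntax.lean`, in the sentential Henkin style: all lines are
(pre-)sentences of the language extended by the parameters `param c`, quantifier instances are by
*closed* terms, and generalisation is *generalisation on a fresh constant* (Enderton, Thm. 24F)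
taken as a primitive rule. Tracking the hypotheses actually used (rather than an ambient set) makes
the side condition of that rule local, so that derivability from a *set* of hypotheses
(`Provable S φ := ∃ U ⊆ S, Derives U φ`) is monotone in `S` for free.

Axiom schemes (Enderton §2.4, groups 1–6, with the tautologies replaced by the three Frege–
Łukasiewicz schemes): `P1 φ → ψ → φ`, `P2 (φ → ψ → χ) → (φ → ψ) → φ → χ`, `P3 ¬¬φ → φ`,
`Q1 ∀φ → φ[s]` (`s` a closed term), `Q2 ∀(φ → ψ) → ∀φ → ∀ψ`, `Q3 φ → ∀φ↑`, `E1 t = t`,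
`E2 s = t → φ[s] → φ[t]`; rules: modus ponens and `Gen`: from `φ[c]` infer `∀φ` provided the
parameter `c` occurs neither in `φ` nor in the hypotheses used.

## Main statements

* `Derives.sound` — soundness in every nonempty `L`-structure, for every language `L` with
  encodable symbols (Enderton §2.5 Soundness Theorem). [folklore]
* `Derives.deduction` — the deduction theorem (Enderton §2.4, "Deduction Theorem", unnumbered).
  [folklore]
* a small kit of derived propositional rules used by the completeness proof.

## References

* H. B. Enderton, *A Mathematical Introduction to Logic*, Academic Press (1972), §2.4 (the
  deductive calculus, deduction theorem, generalization on constants Thm. 24F), §2.5 (soundness).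
-/

namespace Literature.ModelTheory.ProofTheory.PreFOL

open FirstOrder FirstOrder.Language

open PreFormula

/-! ### The calculus -/

/-- `Derives U φ`: the pre-sentence `φ` is derivable in the Hilbert calculus using exactly the
list `U` of hypotheses (with multiplicity, in the order the leaves occur). Generalisation on a
constant `gen` requires the constant to be absent from `φ` and from the hypotheses used
(Enderton, §2.4 and Thm. 24F). [folklore] -/
inductive Derives : List PreFormula → PreFormula → Prop
  | hyp (φ : PreFormula) : Derives [φ] φ
  | p1 (φ ψ : PreFormula) : Derives [] (imp φ (imp ψ φ))
  | p2 (φ ψ χ : PreFormula) : Derives [] (imp (imp φ (imp ψ χ)) (imp (imp φ ψ) (imp φ χ)))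
  | p3 (φ : PreFormula) : Derives [] (imp (imp (imp φ falsum) falsum) φ)
  | q1 (φ : PreFormula) {s : PreTerm} : s.closedTerm = true → Derives [] (imp (all φ) (φ.inst 0 s))
  | q2 (φ ψ : PreFormula) : Derives [] (imp (all (imp φ ψ)) (imp (all φ) (all ψ)))
  | q3 (φ : PreFormula) : Derives [] (imp φ (all (φ.liftAt 0)))
  | e1 (t : PreTerm) : Derives [] (equal t t)
  | e2 (φ : PreFormula) {s t : PreTerm} : s.closedTerm = true → t.closedTerm = true →
      Derives [] (imp (equal s t) (imp (φ.inst 0 s) (φ.inst 0 t)))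
  | mp {U V : List PreFormula} {φ ψ : PreFormula} :
      Derives U (imp φ ψ) → Derives V φ → Derives (U ++ V) ψ
  | gen {U : List PreFormula} {φ : PreFormula} {c : ℕ} :
      Derives U (φ.inst 0 (PreTerm.param c)) → c ∉ φ.params → (∀ ψ ∈ U, c ∉ ψ.params) →
      Derives U (all φ)

/-- Derivability from a set of hypotheses: some list of members of `S` derives `φ`. [folklore] -/
def Provable (S : Set PreFormula) (φ : PreFormula) : Prop :=
  ∃ U : List PreFormula, (∀ ψ ∈ U, ψ ∈ S) ∧ Derives U φ

/-- A set of pre-sentences is consistent if it does not derive `⊥`. [folklore] -/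
def Consistent (S : Set PreFormula) : Prop :=
  ¬ Provable S falsum

namespace Derives

/-- Transport along an equality of hypothesis lists. [folklore] -/
theorem cast {U V : List PreFormula} {φ : PreFormula} (h : Derives U φ) (e : U = V) : Derives V φ :=
  e ▸ h

/-- Modus ponens with a hypothesis-free major premise. [folklore] -/
theorem mp₀ {U : List PreFormula} {φ ψ : PreFormula} (h₁ : Derives [] (imp φ ψ)) (h₂ : Derives U φ) :
    Derives U ψ :=
  mp h₁ h₂

/-- Modus ponens with a hypothesis-free minor premise. [folklore] -/
theorem mp₁ {U : List PreFormula} {φ ψ : PreFormula} (h₁ : Derives U (imp φ ψ)) (h₂ : Derives [] φ) :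
    Derives U ψ :=
  (mp h₁ h₂).cast (List.append_nil U)

/-- `⊢ φ → φ`. [folklore] -/
theorem imp_self (φ : PreFormula) : Derives [] (imp φ φ) :=
  mp₁ (mp₀ (p2 φ (imp φ φ) φ) (p1 φ (imp φ φ))) (p1 φ φ)

/-- Weakening of the conclusion: `U ⊢ ψ` gives `U ⊢ φ → ψ`. [folklore] -/
theorem imp_intro {U : List PreFormula} (φ : PreFormula) {ψ : PreFormula} (h : Derives U ψ) :
    Derives U (imp φ ψ) :=
  mp₀ (p1 ψ φ) h

/-- **Deduction theorem** (Enderton §2.4): if `φ` is derivable with hypotheses `U`, then `σ → φ` is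
derivable with the hypotheses of `U` other than `σ`. [folklore] -/
theorem deduction (σ : PreFormula) {U : List PreFormula} {φ : PreFormula} (h : Derives U φ) :
    Derives (U.filter (· ≠ σ)) (imp σ φ) := by
  induction h with
  | hyp φ =>
      by_cases e : φ = σ
      · subst e
        simpa using imp_self φ
      · simpa [e] using imp_intro σ (hyp φ)
  | p1 φ ψ => exact imp_intro σ (p1 φ ψ)
  | p2 φ ψ χ => exact imp_intro σ (p2 φ ψ χ)
  | p3 φ => exact imp_intro σ (p3 φ)
  | q1 φ hs => exact imp_intro σ (q1 φ hs)
  | q2 φ ψ => exact imp_intro σ (q2 φ ψ)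
  | q3 φ => exact imp_intro σ (q3 φ)
  | e1 t => exact imp_intro σ (e1 t)
  | e2 φ hs ht => exact imp_intro σ (e2 φ hs ht)
  | @mp U V φ ψ _ _ ih₁ ih₂ =>
      rw [List.filter_append]
      exact mp (mp₀ (p2 σ φ ψ) ih₁) ih₂
  | @gen U φ c h hc hU ih =>
      by_cases hσ : σ ∈ U
      · have hcσ : c ∉ σ.params := hU σ hσ
        have e : imp σ (φ.inst 0 (PreTerm.param c)) =
            (imp (σ.liftAt 0) φ).inst 0 (PreTerm.param c) := by
          simp [PreFormula.inst]
        rw [e] at ih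
        have hg : Derives (U.filter (· ≠ σ)) (all (imp (σ.liftAt 0) φ)) := by
          refine gen ih ?_ ?_
          · simp only [params, params_liftAt, Finset.mem_union, not_or]
            exact ⟨hcσ, hc⟩
          · intro ψ hψ
            exact hU ψ (List.mem_of_mem_filter hψ)
        have h2 : Derives (U.filter (· ≠ σ)) (imp (all (σ.liftAt 0)) (all φ)) :=
          mp₀ (q2 _ _) hg
        -- σ → ∀σ↑ → ∀φ
        exact mp₁ (mp₀ (p2 σ (all (σ.liftAt 0)) (all φ)) (imp_intro σ h2)) (q3 σ)
      · have e : U.filter (· ≠ σ) = U := by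
          rw [List.filter_eq_self]
          intro ψ hψ
          simp only [ne_eq, decide_eq_true_eq]
          rintro rfl
          exact hσ hψ
        rw [e]
        exact imp_intro σ (gen h hc hU)

/-- Deduction theorem for a hypothesis in front. [folklore] -/
theorem deduction_cons (σ : PreFormula) {U : List PreFormula} {φ : PreFormula}
    (h : Derives (σ :: U) φ) : Derives (U.filter (· ≠ σ)) (imp σ φ) := by
  simpa using deduction σ h

/-- Transitivity of implication: `U ⊢ φ → ψ` and `V ⊢ ψ → χ` give `U ++ V ⊢ φ → χ` (up to the
order of hypotheses). [folklore] -/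
theorem imp_trans {U V : List PreFormula} {φ ψ χ : PreFormula}
    (h₁ : Derives U (imp φ ψ)) (h₂ : Derives V (imp ψ χ)) : Derives (V ++ U) (imp φ χ) :=
  mp (mp₀ (p2 φ ψ χ) (imp_intro φ h₂)) h₁

/-- Ex falso: `⊢ ⊥ → φ`. [folklore] -/
theorem exfalso (φ : PreFormula) : Derives [] (imp falsum φ) :=
  (imp_trans (p1 falsum (imp φ falsum)) (p3 φ)).cast rfl

/-- `φ → ψ` is never `ψ`. [folklore] -/
theorem _root_.Literature.ModelTheory.ProofTheory.PreFOL.PreFormula.imp_ne_right (φ ψ : PreFormula) : imp φ ψ ≠ ψ := by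
  intro e
  have := congrArg sizeOf e
  simp only [imp.sizeOf_spec] at this
  omega

/-- `φ → ψ` is never `φ`. [folklore] -/
theorem _root_.Literature.ModelTheory.ProofTheory.PreFOL.PreFormula.imp_ne_left (φ ψ : PreFormula) : imp φ ψ ≠ φ := by
  intro e
  have := congrArg sizeOf e
  simp only [imp.sizeOf_spec] at this
  omega

/-- `⊢ ¬φ → φ → ψ`. [folklore] -/
theorem not_imp (φ ψ : PreFormula) : Derives [] (imp (not φ) (imp φ ψ)) := by
  -- from hypotheses [¬φ] and [φ]: ⊥, hence ψ; discharge twice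
  have h1 : Derives ([not φ] ++ [φ]) falsum := mp (hyp (not φ)) (hyp φ)
  have h2 : Derives ([not φ] ++ [φ]) ψ := mp₀ (exfalso ψ) h1
  have h3 := deduction φ h2
  have h4 := deduction (not φ) h3
  simpa [PreFormula.imp_ne_left] using h4

/-- Double-negation introduction `⊢ φ → ¬¬φ`. [folklore] -/
theorem dni (φ : PreFormula) : Derives [] (imp φ (not (not φ))) := by
  have h1 : Derives ([not φ] ++ [φ]) falsum := mp (hyp (not φ)) (hyp φ)
  have h2 := deduction (not φ) h1
  have h3 := deduction φ h2
  have e' : ¬ (not φ = φ) := PreFormula.imp_ne_left _ _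
  have e : ¬ (φ = not φ) := fun h => e' h.symm
  simpa [e, e'] using h3

/-- From `U ⊢ ¬(φ → ψ)` infer `U ⊢ φ`. [folklore] -/
theorem left_of_not_imp {U : List PreFormula} {φ ψ : PreFormula} (h : Derives U (not (imp φ ψ))) :
    Derives U φ := by
  -- ¬φ → (φ → ψ), so ¬(φ → ψ) → ¬¬φ → φ
  have h1 : Derives ([not (imp φ ψ)] ++ [not φ]) falsum :=
    mp (hyp _) (mp₀ (not_imp φ ψ) (hyp (not φ)))
  have h2 := deduction (not φ) h1
  have e : ¬ (not (imp φ ψ) = not φ) := by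
    intro e; injection e with e; exact PreFormula.imp_ne_left _ _ e
  have h3 : Derives [not (imp φ ψ)] (not (not φ)) := by simpa [e] using h2
  have h4 : Derives [not (imp φ ψ)] φ := mp₀ (p3 φ) h3
  have h5 := deduction (not (imp φ ψ)) h4
  simp at h5
  exact (mp h5 h).cast rfl

/-- From `U ⊢ ¬(φ → ψ)` infer `U ⊢ ¬ψ`. [folklore] -/
theorem not_right_of_not_imp {U : List PreFormula} {φ ψ : PreFormula}
    (h : Derives U (not (imp φ ψ))) : Derives U (not ψ) := by
  have h1 : Derives ([not (imp φ ψ)] ++ [ψ]) falsum := mp (hyp _) (imp_intro φ (hyp ψ))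
  have h2 := deduction ψ h1
  have e : ¬ (not (imp φ ψ) = ψ) := fun e => by
    have := congrArg sizeOf e; simp at this; omega
  have h3 : Derives [not (imp φ ψ)] (not ψ) := by simpa [e] using h2
  have h4 := deduction (not (imp φ ψ)) h3
  simp at h4
  exact (mp h4 h).cast rfl

/-- From `U ⊢ φ` and `V ⊢ ¬φ` infer `V ++ U ⊢ ⊥`. [folklore] -/
theorem falsum_of_not {U V : List PreFormula} {φ : PreFormula} (h₁ : Derives U φ)
    (h₂ : Derives V (not φ)) : Derives (V ++ U) falsum :=
  mp h₂ h₁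

end Derives

/-! ### Soundness -/

section Soundness

variable {L : Language} [Encodable (Σ i, L.Functions i)] [Encodable (Σ i, L.Relations i)]
variable {M : Type*} [L.Structure M] [Nonempty M]

/-- **Soundness** (Enderton §2.5): every line of a derivation holds in every nonempty
`L`-structure under every parameter assignment satisfying the hypotheses used. The `gen` case
re-assigns the fresh constant (Enderton Thm. 24F); the quantifier axioms use the substitution
lemmas of `PreSemantics`. [folklore] -/
theorem Derives.sound {U : List PreFormula} {φ : PreFormula} (h : Derives U φ) :
    ∀ κ : ℕ → M, (∀ ψ ∈ U, ψ.Realize L κ []) → φ.Realize L κ [] := by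
  induction h with
  | hyp φ => exact fun κ hU => hU φ (by simp)
  | p1 φ ψ => intro κ _; simp only [Realize]; exact fun a _ => a
  | p2 φ ψ χ => intro κ _; simp only [Realize]; exact fun a b c => a c (b c)
  | p3 φ => intro κ _; simp only [Realize]; exact fun a => Classical.byContradiction fun b => a b
  | q1 φ hs =>
      intro κ _
      simp only [Realize, List.nil_append]
      intro ha
      rw [realize_inst_zero κ hs]
      exact ha _
  | q2 φ ψ => intro κ _; simp only [Realize]; exact fun a b x => a x (b x)
  | q3 φ =>
      intro κ _
      simp only [Realize, List.nil_append]
      intro hφ a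
      have := realize_liftAt (L := L) κ [] a φ []
      simp only [List.length_nil, List.nil_append, List.append_nil] at this
      exact this.2 hφ
  | e1 t => intro κ _; simp only [Realize]
  | e2 φ hs ht =>
      intro κ _
      simp only [Realize]
      intro hst hφ
      rw [realize_inst_zero κ hs] at hφ
      rw [realize_inst_zero κ ht]
      rw [PreTerm.eval_of_closedTerm κ [] hs, PreTerm.eval_of_closedTerm κ [] ht] at hst
      simp only at hst
      rwa [← hst]
  | mp _ _ ih₁ ih₂ =>
      intro κ hUV
      exact ih₁ κ (fun ψ hψ => hUV ψ (List.mem_append_left _ hψ))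
        (ih₂ κ (fun ψ hψ => hUV ψ (List.mem_append_right _ hψ)))
  | @gen U φ c _ hc hU ih =>
      intro κ hκ
      simp only [Realize, List.nil_append]
      intro a
      let κ' : ℕ → M := Function.update κ c a
      have h1 : ∀ ψ ∈ U, ψ.Realize L κ' [] := fun ψ hψ =>
        (realize_congr_params [] (fun d hd => by
          simp only [κ']
          rw [Function.update_of_ne]
          rintro rfl
          exact hU ψ hψ hd)).1 (hκ ψ hψ)
      have h2 := ih κ' h1
      rw [realize_inst_zero κ' (by rfl)] at h2
      simp only [PreTerm.eval, κ', Function.update_self] at h2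
      exact (realize_congr_params [a] (fun d hd => by
        rw [Function.update_of_ne]
        rintro rfl
        exact hc hd)).1 h2

/-- Soundness for derivability from a set of hypotheses. [folklore] -/
theorem Provable.sound {S : Set PreFormula} {φ : PreFormula} (h : Provable S φ) (κ : ℕ → M)
    (hS : ∀ ψ ∈ S, ψ.Realize L κ []) : φ.Realize L κ [] := by
  obtain ⟨U, hU, hd⟩ := h
  exact hd.sound κ fun ψ hψ => hS ψ (hU ψ hψ)

/-- A set of pre-sentences with a model is consistent. [folklore] -/
theorem Consistent.of_model {S : Set PreFormula} (κ : ℕ → M) (hS : ∀ ψ ∈ S, ψ.Realize L κ []) :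
    Consistent S :=
  fun h => h.sound (L := L) κ hS

end Soundness

/-! ### Derivability from sets -/

namespace Provable

/-- Monotonicity in the set of hypotheses. [folklore] -/
theorem mono {S S' : Set PreFormula} (hSS' : S ⊆ S') {φ : PreFormula} (h : Provable S φ) :
    Provable S' φ := by
  obtain ⟨U, hU, hd⟩ := h
  exact ⟨U, fun ψ hψ => hSS' (hU ψ hψ), hd⟩

/-- Hypotheses are derivable. [folklore] -/
theorem of_mem {S : Set PreFormula} {φ : PreFormula} (h : φ ∈ S) : Provable S φ :=
  ⟨[φ], by simpa using h, Derives.hyp φ⟩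

/-- Hypothesis-free derivations. [folklore] -/
theorem of_derives {S : Set PreFormula} {φ : PreFormula} (h : Derives [] φ) : Provable S φ :=
  ⟨[], by simp, h⟩

/-- Modus ponens. [folklore] -/
theorem mp {S : Set PreFormula} {φ ψ : PreFormula} (h₁ : Provable S (imp φ ψ)) (h₂ : Provable S φ) :
    Provable S ψ := by
  obtain ⟨U, hU, hd₁⟩ := h₁
  obtain ⟨V, hV, hd₂⟩ := h₂
  refine ⟨U ++ V, fun χ hχ => ?_, Derives.mp hd₁ hd₂⟩
  rcases List.mem_append.1 hχ with hχ | hχ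
  · exact hU χ hχ
  · exact hV χ hχ

/-- Deduction theorem for sets: `S ∪ {σ} ⊢ φ` gives `S ⊢ σ → φ`. [folklore] -/
theorem deduction {S : Set PreFormula} {σ φ : PreFormula} (h : Provable (insert σ S) φ) :
    Provable S (imp σ φ) := by
  obtain ⟨U, hU, hd⟩ := h
  refine ⟨U.filter (· ≠ σ), fun ψ hψ => ?_, hd.deduction σ⟩
  simp only [List.mem_filter, ne_eq, decide_not, Bool.not_eq_eq_eq_not, Bool.not_true,
    decide_eq_false_iff_not] at hψ
  rcases Set.mem_insert_iff.1 (hU ψ hψ.1) with h | h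
  · exact absurd h hψ.2
  · exact h

/-- Converse of the deduction theorem. [folklore] -/
theorem of_imp {S : Set PreFormula} {σ φ : PreFormula} (h : Provable S (imp σ φ)) :
    Provable (insert σ S) φ :=
  (h.mono (Set.subset_insert _ _)).mp (of_mem (Set.mem_insert _ _))

end Provable

namespace Consistent

/-- If `S ∪ {¬φ}` is inconsistent then `S ⊢ φ`. [folklore] -/
theorem provable_of_inconsistent_insert_not {S : Set PreFormula} {φ : PreFormula}
    (h : ¬ Consistent (insert (not φ) S)) : Provable S φ := by
  unfold Consistent at h
  push Not at h
  exact (Provable.of_derives (Derives.p3 φ)).mp (Provable.deduction h)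

/-- If `S ∪ {φ}` is inconsistent then `S ⊢ ¬φ`. [folklore] -/
theorem provable_not_of_inconsistent_insert {S : Set PreFormula} {φ : PreFormula}
    (h : ¬ Consistent (insert φ S)) : Provable S (not φ) := by
  unfold Consistent at h
  push Not at h
  exact Provable.deduction h

/-- If `S ⊬ φ` then `S ∪ {¬φ}` is consistent. [folklore] -/
theorem insert_not {S : Set PreFormula} {φ : PreFormula} (h : ¬ Provable S φ) :
    Consistent (insert (not φ) S) := by
  by_contra h'
  exact h (provable_of_inconsistent_insert_not h')

/-- Subsets of consistent sets are consistent. [folklore] -/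
theorem mono {S S' : Set PreFormula} (hSS' : S ⊆ S') (h : Consistent S') : Consistent S :=
  fun hS => h (hS.mono hSS')

end Consistent

end Literature.ModelTheory.ProofTheory.PreFOL
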